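import Literature.MathematicalPhysics.QuantumFieldTheory.Balaban1983to89.B6Prop26KLevelAssemblyV1
import Literature.MathematicalPhysics.QuantumFieldTheory.Balaban1983to89.B6CubeMoutV1

/-!
# `Balaban1983to89.B6Prop26KLevelAssemblyV1PerCube` — T. Bałaban, *Propagators and renormalization transformations for lattice gauge theories. II*,
# Commun. Math. Phys. **96** (1984) 223–250 [Balaban1984PropagatorsII], Prop. 2.6 (2.136)₁ p. 247 for the GENUINE `k`-level `G = Δ_a⁻¹` on the V1
# torus: r03's assembly `…B6Prop26KLevelAssemblyV1.prop26_2136_kLevel_assembly_nbig` WITH THE TWO p38 PER-CUBE INPUTS DISCHARGED BY NAME —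
# (ii) the output localisation `OutLoc (M_□h_□) □̃` (`…B6CubeMoutV1.outLoc_Ml_hB'`) and (iii) the sizes and supports of the line-1 coefficients
# `c_e = s(□)·E_eh_□`, `c₀ = s(□)·Δh_□` (`…B6CubeCoeffSizesV1.abs_cfC_le` / `cfC_supp` / `abs_c0C_le` / `c0C_supp`, `s₁ = C1F·L³`, `s₂ = (d+1)·C2F·L`)

statement-level skeleton of published theorems with citation tags; proofs where landed; nothing here is a claim about the Yang–Mills mass gap

PDF held: `paper:balaban1984-cmp96-propagators-rt-ii` (journal page = PDF page + 222): p. 247 [PDF 25] ((2.133)–(2.136), Prop. 2.6; *"|∂h_□| ≤ O(1)(ML^jη)^{−1}, |Δh_□| ≤ O(1)M^{−1}(L^jη)^{−2}"*), p. 239 [PDF 17] ((2.89)–(2.94); ζ_□ *"equal to 1 on a cube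
containing □ … equal to 0 outside a similar cube"* — the supports of h_□, ζ_□ in □̃ are our paraphrase of this, NOT a printed sentence: v1.1 DOCFIX per ref-4
D-g67-1, v1 had «these functions have supports in □̃» in quotation marks; Lean content unchanged); read from the tree transcriptions in the
imported modules.

CITATION HEADER (lean-in-tree rule) — WHAT IS REPRODUCED.  Phase-2 file of the `lit-balaban` typed skeleton (HOME `run/shared/lean/pub/lit-balaban/`), seat
**p38 gen 29** (literature-prover-lit-balaban-p38-g29-0) for the row owner r03 (B6.Prop2.6; referee ref-4).  SKELETON rows **B6.Prop2.6** × **B6.Eq2.134** ×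
B6.Eq2.92 × B6.Eq2.36 (cells only; decls of record untouched).  IMPORTS BY NAME, restating nothing: `…B6Prop26KLevelAssemblyV1` (r03 g21:
`prop26_2136_kLevel_assembly_nbig`, its `L = 5` twin is re-derived here from the general one), `…B6CubeMoutV1` (p38 g28: `outLoc_Ml_hB'`),
`…B6CubeCoeffSizesV1` (p38 g27–28: `abs_cfC_le`, `cfC_supp`, `abs_c0C_le`, `c0C_supp`, `s1C_nonneg`, `s2C_nonneg`), `…B6CubeWindowV1` (r03: `Placed`,
`placed_all_cubes`, `Pl`, `GlobalBand`).

## WHAT THIS FILE CERTIFIES (kernel-checked, 0 sorry, standard axioms; THEOREMS ONLY — no `def`, no `def … : Prop`, no new named fact)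

* **`prop26_2136_kLevel_assembly_line3`** — PROPOSITION 2.6, ENTRY (2.136)₁, FOR THE GENUINE k-LEVEL `G` ON THE V1 TORUS with, of r03's four displayed
  per-cube inputs, ONLY THE LINE-3 MAJORANT (iv) LEFT: for the weight band `[b₀, b₁]` there is `σ > 0` such that for every Lemma-2.1 budget `(α, N₀)` and
  line-3 constants `C_D ≥ 0`, `c_D > 0` there are `A ≥ 0`, `M₁ > 0` with — on every admissible V1 torus (`k ≥ 2`, `M_h = L^a ≥ 8`, `R ≥ 2L²`, `P′ ≥ 5`,
  `L ≥ 5`, all cubes placed, `L·M_h ≥ M₁`, `N₀ + 1 ≤ R·L·M_h`, the (2.59)-shape threshold at rate `σ`), for `c′ ≠ 0` and weights in the global band,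
  GIVEN the line-3 majorant `HasMajorant (ζ_□(∂(1−R)∂* − P_□)h_□) (C_D c′² e^{−c_D M}/len²·e^{−2σ d_T})` for every cube —
  `HasMajorant (geomT D) (blkV1 hN D) G (A·(L^{j(y)}/c′)²·e^{−delta3 α (2σ)·d_T(y,y′)})`.
  Inside: (i) `Nbig = 3·9^{d+1}` (r03's `_nbig`), (ii) `outLoc_Ml_hB'`, (iii) `abs_cfC_le`/`cfC_supp`/`abs_c0C_le`/`c0C_supp` with
  `s₁ := C1F d ℓ·(ℓ+1)³`, `s₂ := (d+1)·C2F d ℓ·(ℓ+1)` (both `c′`-free, as the assembly's rescaling requires).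
* **`prop26_2136_kLevel_assembly_L5_line3`** — the same at `L = 5` (`ℓ = 4`), `P′_μ ≥ 12`, where the canonical chart places every cube
  (`placed_all_cubes`): no geometric hypothesis on the cubes left; displayed = line 3 + the Lemma-2.1 budget.

## HONEST SCOPE / DIVERGENCES

(1) What stays displayed: the line-3 majorant (iv) of `ζ_□(∂(1−R)∂* − P_□)h_□` (the by-parts route: p38 `line3P_hasMajorant_gk_zone_cut` + p22
`B6Line3WindowV1.line3_window` + the cube's χ/zone data — in progress, p22 g20 / r03 g21) and the Lemma-2.1 budget `(α, N₀)` with its threshold; the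
placement of the top cubes for general `L` (`Placed`; automatic at `L = 5`, `P′ ≥ 12`).  (2) As the assembly: `L ≥ 5`, `M_h = L^a ≥ 8`, `R ≥ 2L²`,
`P′ ≥ 5`, `k ≥ 2`; constants `A`, `M₁` on `d, L, b₀, b₁, α, N₀, C_D, c_D` only (uniform in `k`, `M_h`, `m`, `K`, `c′`).  (3) Entries (2.136)₂₋₄ /
(2.137)–(2.140) untouched; integer torus, lattice units; nothing on d = 4 or the continuum; value = two displayed hypotheses of the k-level (2.136)₁ removed
by landed theorems; NOT summit progress.  Unit `lit-balaban-p38` (gen 29), 2026-08-23.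
-/

open scoped BigOperators
open Finset

namespace Literature.MathematicalPhysics.QuantumFieldTheory.Balaban1983to89.B6Prop26KLevelAssemblyV1PerCube

open B4Reflection242 (boxDom)
open B6MultiLevelBoxOperator (N0)
open B6MultiLevelTorusOperator (TDomains)
open B6Cover236MultiLevelBlocks (cubes)
open B6Geom246MultiLevelTorus (geomT)
open B8Ineq192MultiLevelTorus (geomTB)
open B6RandomWalk (HasMajorant delta3)
open B6Prop26Gluing (mulOp)
open B6Ineq2133TwoScaleV1 (onFun)
open B6GlobalChartV1 (PV domT blkV1)
open B6SectAOperatorsV1 (dE dsE RE BondIdx)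
open B6SectAVectorModelV1 (GE)
open B6Prop26KLevelSkeletonV1 (hB zB pref)
open B6CubeWindowV1 (Placed Pl GlobalBand placed_all_cubes band_le one_le_of_eight_le four_le_of_five_le)
open B6CubeCoeffSizesV1 (abs_cfC_le cfC_supp abs_c0C_le c0C_supp s1C_nonneg s2C_nonneg)
open B6CubeMoutV1 (outLoc_Ml_hB')
open B6Prop26KLevelAssemblyV1 (prop26_2136_kLevel_assembly_nbig)

noncomputable section

variable {d ℓ : ℕ} {hd : 1 ≤ d + 1} {hL : Odd (ℓ + 1) ∧ 1 < ℓ + 1} {m K : ℕ} {Mh k R : ℕ} {P' : Fin (d + 1) → ℕ}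

/-! ## §1  The k-level (2.136)₁ with (ii) `hMout` and (iii) the line-1 sizes/supports discharged -/

section Line3

open Classical in
/-- **PROPOSITION 2.6, ENTRY (2.136)₁, FOR THE GENUINE k-LEVEL `G = Δ_a⁻¹` ON THE V1 TORUS — ONLY LINE 3 DISPLAYED.**  r03's
`prop26_2136_kLevel_assembly_nbig` with hypothesis (ii) fed by `B6CubeMoutV1.outLoc_Ml_hB'` (the local operator `M_□` applied after `h_□` has outputs on the
blocks of `□̃`: Δ-part bond range one step, `Q*a_□Q` under one member index bond, supports in □̃ — paraphrase of p. 239, cf. header) and hypotheses (iii) fed by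
`B6CubeCoeffSizesV1.abs_cfC_le`/`cfC_supp`/`abs_c0C_le`/`c0C_supp` (p. 247 *"|∂h_□| ≤ O(1)(ML^jη)^{−1}, |Δh_□| ≤ O(1)M^{−1}(L^jη)^{−2}"* with supports over
`□⁺`; `s₁ = C1F·L³`, `s₂ = (d+1)·C2F·L`).  For the weight band `[b₀, b₁]` there is `σ > 0`; for every budget `α ∈ [0,1]`, `N₀ ≥ 1` and line-3 constants
`C_D ≥ 0`, `c_D > 0` there are `A ≥ 0`, `M₁ > 0` such that on every admissible V1 torus, GIVEN the line-3 majorant of `ζ_□(∂(1−R)∂* − P_□)h_□` at rate `2σ`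
for every cube, `|G(x,x′)| ≤ A·(L^{j(y)}/c′)²·e^{−δ₃ d_T(y,y′)}` blockwise, `δ₃ = delta3 α (2σ)`.
[cite: Balaban1984PropagatorsII, Prop. 2.6 (2.136) p.247, (2.133)–(2.135) p.247, (2.88)–(2.94) pp.238–239, (2.36) p.229, Lemma 2.1 p.234] -/
theorem prop26_2136_kLevel_assembly_line3 (d ℓ : ℕ) (hd : 1 ≤ d + 1) (hL : Odd (ℓ + 1) ∧ 1 < ℓ + 1) {b₀ b₁ : ℝ} (hb₀ : 0 < b₀) (hb₁ : b₀ ≤ b₁) :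
    ∃ σ : ℝ, 0 < σ ∧ ∀ (α : ℝ), 0 ≤ α → α ≤ 1 → ∀ (N₀ : ℕ), 0 < N₀ → ∀ {CD cD : ℝ}, 0 ≤ CD → 0 < cD →
    ∃ A M₁ : ℝ, 0 ≤ A ∧ 0 < M₁ ∧
    ∀ (m K : ℕ) {Mh k R : ℕ} {P' : Fin (d + 1) → ℕ}
      (hN : ∀ μ, N0 ℓ Mh k P' μ = (PV d ℓ m K hd hL).sitesPerDir 0) (D : TDomains d ℓ Mh k P' R) (hk : k ≤ m + K) (_ : 2 ≤ k)
      {a : ℕ} (hMha : Mh = (ℓ + 1) ^ a) (hM8 : 8 ≤ Mh) (_ : 2 * (ℓ + 1) ^ 2 ≤ R) (hP5 : ∀ μ, 5 ≤ P' μ) (_ : 4 ≤ ℓ)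
      (hpl : ∀ c : ↥(cubes D.toDomains), Placed ℓ k P' c.1)
      (_ : M₁ ≤ ((ℓ : ℝ) + 1) * Mh) (_ : N₀ + 1 ≤ R * ((ℓ + 1) * Mh))
      (_ : Real.exp (-(α * σ)) * ((ℓ : ℝ) + 1) ^ ((2 * (d + 1 : ℕ) : ℝ) / N₀) < 1)
      {cf : ℝ} (hcf : cf ≠ 0) {w : BondIdx (domT hN D hk) → ℝ} (hw : ∀ i, 0 < w i) (_ : GlobalBand b₀ b₁ cf w)
      -- line 3 (p38/p22), the only per-cube input left
      (_ : ∀ c : ↥(cubes D.toDomains), HasMajorant (g := geomTB D) (blkV1 hN D)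
        (mulOp (zB hN D (one_le_of_eight_le hM8) (four_le_of_five_le hP5) c) *
          (onFun (dE (P := PV d ℓ m K hd hL) cf ∘ₗ (LinearMap.id - RE (domT hN D hk) cf) ∘ₗ dsE cf) -
            Pl hN hk (one_le_of_eight_le hM8) (four_le_of_five_le hP5) hMha c (band_le (d := d) (ℓ := ℓ) hb₀ hb₁) (hpl c) w cf) *
          mulOp (hB hN D c))
        (fun y y'' => CD * cf ^ 2 * Real.exp (-(cD * (geomTB D).M)) / (geomTB D).len y ^ 2 * Real.exp (-((2 * σ) * (geomTB D).dist y y'')))),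
      HasMajorant (g := geomT D) (blkV1 hN D) (onFun (GE (domT hN D hk) hcf hw))
        (fun y y' => A * pref cf y * Real.exp (-(delta3 α (2 * σ) * (geomT D).dist y y'))) := by
  obtain ⟨σ, hσ, h⟩ := prop26_2136_kLevel_assembly_nbig d ℓ hd hL hb₀ hb₁
  refine ⟨σ, hσ, fun α hα0 hα1 N₀ hN₀ CD cD hCD hcD => ?_⟩
  obtain ⟨A, M₁, hA, hM₁, h2⟩ := h α hα0 hα1 N₀ hN₀ (s1C_nonneg d ℓ) (s2C_nonneg d ℓ) hCD hcD
  refine ⟨A, M₁, hA, hM₁, ?_⟩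
  intro m K Mh k R P' hN D hk hk2 a hMha hM8 hR2 hP5 hℓ hpl hLM hRM hθ cf hcf w hw hwb hD3
  exact h2 m K hN D hk hk2 hMha hM8 hR2 hP5 hℓ hpl hLM hRM hθ hcf hw hwb
    (fun c => outLoc_Ml_hB' hN hk (one_le_of_eight_le hM8) (four_le_of_five_le hP5) hMha c (band_le (d := d) (ℓ := ℓ) hb₀ hb₁)
      hM8 hR2 hP5 (hpl c) w cf)
    (fun c e x => abs_cfC_le hN hk (one_le_of_eight_le hM8) (four_le_of_five_le hP5) hMha c (band_le (d := d) (ℓ := ℓ) hb₀ hb₁)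
      hM8 hR2 hP5 (hpl c) w cf e x)
    (fun c e x hx => cfC_supp hN hk (one_le_of_eight_le hM8) (four_le_of_five_le hP5) hMha c (band_le (d := d) (ℓ := ℓ) hb₀ hb₁)
      hM8 hR2 hP5 (hpl c) w cf e x hx)
    (fun c x => abs_c0C_le hN hk (one_le_of_eight_le hM8) (four_le_of_five_le hP5) hMha c (band_le (d := d) (ℓ := ℓ) hb₀ hb₁)
      hM8 hR2 hP5 (hpl c) w cf x)
    (fun c x hx => c0C_supp hN hk (one_le_of_eight_le hM8) (four_le_of_five_le hP5) hMha c (band_le (d := d) (ℓ := ℓ) hb₀ hb₁)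
      hM8 hR2 hP5 (hpl c) w cf x hx)
    hD3

open Classical in
/-- **THE SAME AT `L = 5` (`ℓ = 4`), `P′_μ ≥ 12`** — the canonical index-`2` chart places every cube (`B6CubeWindowV1.placed_all_cubes`), so NO geometric
per-cube hypothesis is left: displayed = the line-3 majorant + the Lemma-2.1 budget. [cite: Balaban1984PropagatorsII, Prop. 2.6 (2.136) p.247, (2.36) p.229, p.235, p.247] -/
theorem prop26_2136_kLevel_assembly_L5_line3 (d : ℕ) (hd : 1 ≤ d + 1) (hL : Odd (4 + 1) ∧ 1 < 4 + 1) {b₀ b₁ : ℝ} (hb₀ : 0 < b₀) (hb₁ : b₀ ≤ b₁) :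
    ∃ σ : ℝ, 0 < σ ∧ ∀ (α : ℝ), 0 ≤ α → α ≤ 1 → ∀ (N₀ : ℕ), 0 < N₀ → ∀ {CD cD : ℝ}, 0 ≤ CD → 0 < cD →
    ∃ A M₁ : ℝ, 0 ≤ A ∧ 0 < M₁ ∧
    ∀ (m K : ℕ) {Mh k R : ℕ} {P' : Fin (d + 1) → ℕ}
      (hN : ∀ μ, N0 4 Mh k P' μ = (PV d 4 m K hd hL).sitesPerDir 0) (D : TDomains d 4 Mh k P' R) (hk : k ≤ m + K) (_ : 2 ≤ k)
      {a : ℕ} (hMha : Mh = (4 + 1) ^ a) (hM8 : 8 ≤ Mh) (_ : 2 * (4 + 1) ^ 2 ≤ R) (hP12 : ∀ μ, 12 ≤ P' μ)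
      (_ : M₁ ≤ (((4 : ℕ) : ℝ) + 1) * Mh) (_ : N₀ + 1 ≤ R * ((4 + 1) * Mh))
      (_ : Real.exp (-(α * σ)) * (((4 : ℕ) : ℝ) + 1) ^ ((2 * (d + 1 : ℕ) : ℝ) / N₀) < 1)
      {cf : ℝ} (hcf : cf ≠ 0) {w : BondIdx (domT hN D hk) → ℝ} (hw : ∀ i, 0 < w i) (_ : GlobalBand b₀ b₁ cf w)
      (_ : ∀ c : ↥(cubes D.toDomains), HasMajorant (g := geomTB D) (blkV1 hN D)
        (mulOp (zB hN D (one_le_of_eight_le hM8) (four_le_of_five_le (fun μ => le_trans (by norm_num) (hP12 μ))) c) *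
          (onFun (dE (P := PV d 4 m K hd hL) cf ∘ₗ (LinearMap.id - RE (domT hN D hk) cf) ∘ₗ dsE cf) -
            Pl hN hk (one_le_of_eight_le hM8) (four_le_of_five_le (fun μ => le_trans (by norm_num) (hP12 μ))) hMha c
              (band_le (d := d) (ℓ := 4) hb₀ hb₁) (placed_all_cubes (D := D) rfl hP12 c) w cf) *
          mulOp (hB hN D c))
        (fun y y'' => CD * cf ^ 2 * Real.exp (-(cD * (geomTB D).M)) / (geomTB D).len y ^ 2 * Real.exp (-((2 * σ) * (geomTB D).dist y y'')))),
      HasMajorant (g := geomT D) (blkV1 hN D) (onFun (GE (domT hN D hk) hcf hw))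
        (fun y y' => A * pref cf y * Real.exp (-(delta3 α (2 * σ) * (geomT D).dist y y'))) := by
  obtain ⟨σ, hσ, h⟩ := prop26_2136_kLevel_assembly_line3 d 4 hd hL hb₀ hb₁
  refine ⟨σ, hσ, fun α hα0 hα1 N₀ hN₀ CD cD hCD hcD => ?_⟩
  obtain ⟨A, M₁, hA, hM₁, h2⟩ := h α hα0 hα1 N₀ hN₀ hCD hcD
  refine ⟨A, M₁, hA, hM₁, ?_⟩
  intro m K Mh k R P' hN D hk hk2 a hMha hM8 hR2 hP12 hLM hRM hθ cf hcf w hw hwb hD3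
  exact h2 m K hN D hk hk2 hMha hM8 hR2 (fun μ => le_trans (by norm_num) (hP12 μ)) le_rfl (placed_all_cubes (D := D) rfl hP12)
    hLM hRM hθ hcf hw hwb hD3

end Line3

end

end Literature.MathematicalPhysics.QuantumFieldTheory.Balaban1983to89.B6Prop26KLevelAssemblyV1PerCube
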